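import Summits.QuantumFields.YangMills.Theorems.BalabanUVNodesN07FrakGPrLetterOfParts
import HarnessLib

/-!
# (QG) MODULO (G₃) — ★★★ director-ym №673 (2), the ONE authorised S–M exception to the (S) HOLD: the block field `Q^{pr}G₁J` of a current factors through the space (115), so the letter
# `|Q^{pr}G₁J|₍₋₀₎ ≤ c₂|J|₍₋₃₎` of ✓`…N07FrakGPrLetterOfParts` follows from (G₃) `‖G₁J‖₍₁₁₅₎ ≤ c₁|J|₍₋₃₎` and ONE letter on def-Y's averaging slot alone, (Q♯) `‖QA‖₍₋₀₎ ≤ c_Q‖A‖₍₁₁₅₎`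

Cell `pub-ymgap` (HUMAN RULING D-0062, Track A), node N07 [B11] ∕ the K0ᴬ port wall; seat `pub-ymgap-dag-n06-l` (g43; N06 bundle F7 = [B9] Thms 3.12∕3.13 — row 21).  ★★★ №673 (ym-nodeO-ideate STATUS
2026-08-31 22:30Z): «(S) STAYS HOLD on the v2 bill; EXCEPTION (optional): (QG) at slot (c) AUTHORISED ONLY in the shape (QG) modulo (G₃): a glue theorem taking (hG₃ : ‖G₁(U₀; Δ₁)J‖₍₁₁₅₎ ≤ c₁|J|₍₋₃₎)
in antecedent position and reading def-Y's `qPrCplxOp` kernel bound by name; if (QG) needs anything of Sects. B–C beyond (G₃), stop».  INSPECTION RESULT: it needs NOTHING of [B9] Sects. B–C beyond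
(G₃); the only other input is a bound on the AVERAGING SLOT ALONE, (Q♯) `‖qReadAt … Q levB A‖₍₋₀₎ ≤ c_Q‖A‖₍₁₁₅₎` — [B9] (3.13)–(3.16) ∕ [B11] (44)–(45) territory (a block average with unitary
transporters; for the FRAMED `Q^{pr} = QprOfRecord U₀ 𝔥` the frame datum's derivative enters `c_Q`).  The tree holds NO by-name operator bound for `qPrCplxOp` ∕ `QprOfRecord` today (node00-def-Y ∕
PT-B letter, S), so (Q♯) is DISPLAYED here, keyed to the slot `Q`.  `--kind definition` (two readings) `--supports stmt-QuantumFields-27238 --as helper`; count-neutral.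
[B9] = [Balaban1985BackgroundPropagators]; [B11] = [Balaban1985Variational].

WHAT IS HERE:
* §1 (lit level) `blockRead115 φ lev₁ Dc Q` — a Hilbert-level averaging `Q : BondL2K →ₗ WL2 wB W` READ `(115) →L[ℂ] |·|₍₋₀₎` (+`_apply`); ★ `curToBlockRead_comp` — `curToBlockRead φ (Q ∘ G) =
  blockRead115 φ Q ∘ toCLM115 (G1Fun φ G)` for any fine operator `G`; ★★ `norm_curToBlockRead_comp_le` — (Q♯) + (G₃) ⟹ (QG) with constant `c_Q·c₁`.
* §2 (record, def-Y's slot-generic letters) `qReadAt F N K k Ω U₀ Q levB`; ★ `qG1ReadAt_eq_comp` (`qG1ReadAt … = qReadAt … ∘ g1CurReadAt …`); ★★ `norm_qG1ReadAt_le_of_g1Cur` — THE AUTHORISED GLUE: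
  (Q♯) + (G₃) ⟹ `‖qG1ReadAt … hpos levB J‖ ≤ c_Q·c₁·‖J‖`; ★★★ `prop4LetterH_frakGOfRecordAt_of_G3_Qsharp` — the (117) letter of `𝔊(U₀; Δ₁)` from (G₃), (Q♯), (ℓa-H), (L):
  `Prop4LetterH (frakGOfRecordAt … Δ₁ Q Q′ a hpos hQ) (c₁ + b·(c_Q c₁) + c₄)` (✓`prop4LetterH_frakGOfRecordAt_of_parts` with its (QG) slot fed by the glue).
AFTER THIS FILE the row-21 bill reads: (G₃) + (L) ([B9] Thm 3.3 ∕ (3.124)–(3.125), XL, HOLD) + (ℓa-H)₍c₎ (⟸ (G₀)+(K) at slot (c) by ✓`prop4LetterH_h1At_of_parts`, XL∕L–XL, HOLD) + (Q♯) (S, the averaging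
owner's).  HONEST FRAMING.  What is PROVED is a factorisation and one product of operator bounds; (G₃), (Q♯), (ℓa-H), (L) are DISPLAYED hypotheses, NOT proved anywhere in the tree; nothing
discharged; K0ᴬ ⟨stmt-QuantumFields-27238⟩ NOT closed; K0ᴬ∕K1ᴬ∕K3ᴬ 0∕3; NODE O 0∕1; COUNT 8∕28 · K 1∕4 UNMOVED; finite `𝕋⁴_{L^K}` at fixed ε — NOT continuum ∕ ℝ⁴ ∕ OS; **the Yang–Mills mass gap
(Clay) is NOT proved by any of this.**  No `sorry`, `instance`, `notation`, `set_option`; standard axioms.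
-/

noncomputable section

open scoped Matrix Matrix.Norms.L2Operator InnerProductSpace ComplexConjugate BigOperators

namespace Summit.QuantumFields.YangMills.BalabanUVNodes.N07QG1LetterOfG3

open Literature.MathematicalPhysics.QuantumFieldTheory.Balaban1983to89
open Literature.MathematicalPhysics.QuantumFieldTheory.Balaban1983to89.Node00
open T4Continuum (T4Family)
open B9SectCLatticeCarrier (Bond)
open B9Eq311L2Pairing (WL2)
open B11Eq115Space (NegSup NegSize Space115 JetSup levWeight)
open B11Eq111FrakG (nabla115 toCLM115 toCLM115_apply jetLinearEquiv)
open B11Eq103H1Complex (SiteL2K BondL2K laplaceALatticeK G1LatticeK funEquiv readFun readFun_apply G1Fun)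
open Summit.QuantumFields.YangMills.BalabanUVNodes.N07FrakGPrLetterOfParts (curToBlockRead curToBlockRead_apply g1CurReadAt qG1ReadAt g1LapG1ReadAt
  prop4LetterH_frakGOfRecordAt_of_parts)

/-! ## §1 Lit level: the averaging `Q` READ from (115) to the blocks, and `(QG₁ on currents) = (Q on (115)) ∘ (G₁ on currents)` -/

section Generic

variable {d : ℕ} {Pd : Fin d → ℕ} {β κ : Type*} [Fintype β] [Fintype κ] {V : Type*} [NormedAddCommGroup V] [NormedSpace ℂ V]
  [FiniteDimensional ℂ V] {W : Type*} [NormedAddCommGroup W] [InnerProductSpace ℂ W] (φ : W ≃ₗ[ℂ] V)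
  {L η : ℝ} [Fact (0 < L)] [Fact (0 < η)] {lev₀ : Bond d Pd → ℕ} {levB : β → ℕ} {c₀ : ℝ} {wB : β → ℝ}

/-- **THE AVERAGING `Q` READ FROM THE SPACE (115) TO THE BLOCK FIELDS**: a Hilbert-level `Q : BondL2K →ₗ WL2 wB W` (e.g. def-Y's `QprOfRecord U₀ 𝔥`, `QOfRecord U₀`) as `(115) →L[ℂ] |·|₍₋₀₎` along the fibre
map `φ` (continuity automatic on the finite lattice).  A reading, nothing asserted. [cite: Balaban1985BackgroundPropagators, (3.13)–(3.16) p.393, (3.113) p.418; Balaban1985Variational, (44)–(45) p.285, (115) p.294] -/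
def blockRead115 (lev₁ : κ → ℕ) (Dc : (Bond d Pd → V) →ₗ[ℂ] (κ → V)) (Q : BondL2K ℂ d Pd c₀ W →ₗ[ℂ] WL2 ℂ wB W) :
    Space115 L η lev₀ lev₁ Dc →L[ℂ] NegSize L η levB 0 V :=
  LinearMap.toContinuousLinearMap
    ((NegSup.linearEquiv ℂ (levWeight L η levB 0) : NegSize L η levB 0 V ≃ₗ[ℂ] (β → V)).symm.toLinearMap ∘ₗ
      (funEquiv φ wB).toLinearMap ∘ₗ Q ∘ₗ (funEquiv φ (fun _ : Bond d Pd => c₀)).symm.toLinearMap ∘ₗ (jetLinearEquiv L η lev₀ lev₁ Dc).toLinearMap)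

/-- Unfolding `blockRead115`. [cite: Balaban1985Variational, (45) p.285 (bookkeeping)] -/
theorem blockRead115_apply (lev₁ : κ → ℕ) (Dc : (Bond d Pd → V) →ₗ[ℂ] (κ → V)) (Q : BondL2K ℂ d Pd c₀ W →ₗ[ℂ] WL2 ℂ wB W) (A : Space115 L η lev₀ lev₁ Dc) :
    NegSup.equiv _ V (blockRead115 (L := L) (η := η) (lev₀ := lev₀) (levB := levB) φ lev₁ Dc Q A) =
      funEquiv φ wB (Q ((funEquiv φ (fun _ : Bond d Pd => c₀)).symm (JetSup.equiv _ _ Dc A))) := rfl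

/-- ★ **`QG₁` ON THE CURRENTS FACTORS THROUGH (115)**: `curToBlockRead φ (Q ∘ G) = blockRead115 φ Q ∘ toCLM115 (G1Fun φ G)` for ANY Hilbert-level fine operator `G` (e.g. `G1LatticeK hpos`).
[cite: Balaban1985BackgroundPropagators, (3.147) p.425, (3.153) p.426; Balaban1985Variational, (111) p.294, (117) p.295] -/
theorem curToBlockRead_comp (lev₁ : κ → ℕ) (Dc : (Bond d Pd → V) →ₗ[ℂ] (κ → V)) (Q : BondL2K ℂ d Pd c₀ W →ₗ[ℂ] WL2 ℂ wB W)
    (G : BondL2K ℂ d Pd c₀ W →ₗ[ℂ] BondL2K ℂ d Pd c₀ W) :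
    curToBlockRead (L := L) (η := η) (lev₀ := lev₀) (levB := levB) φ (Q ∘ₗ G) =
      (blockRead115 (L := L) (η := η) (lev₀ := lev₀) (levB := levB) φ lev₁ Dc Q).comp (toCLM115 lev₁ Dc (G1Fun φ G)) := by
  refine ContinuousLinearMap.ext fun f => (NegSup.equiv _ V).injective ?_
  simp only [ContinuousLinearMap.comp_apply, curToBlockRead_apply, blockRead115_apply, toCLM115_apply, G1Fun, readFun_apply, LinearMap.comp_apply,
    LinearEquiv.symm_apply_apply]

/-- ★★ **(QG) MODULO (G₃), LIT LEVEL**: `‖(Q read on (115)) A‖ ≤ c_Q‖A‖` (`c_Q ≥ 0`) and `‖(G on currents) J‖ ≤ c₁|J|` ⟹ `|(QG)J|₍₋₀₎ ≤ c_Q·c₁·|J|₍₋₃₎`.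
[cite: Balaban1985Variational, (117) p.295, (44)–(46) p.285; Balaban1985BackgroundPropagators, Thm 3.3 p.397, (3.16) p.393] -/
theorem norm_curToBlockRead_comp_le (lev₁ : κ → ℕ) (Dc : (Bond d Pd → V) →ₗ[ℂ] (κ → V)) (Q : BondL2K ℂ d Pd c₀ W →ₗ[ℂ] WL2 ℂ wB W)
    (G : BondL2K ℂ d Pd c₀ W →ₗ[ℂ] BondL2K ℂ d Pd c₀ W) {cQ c₁ : ℝ} (hcQ : 0 ≤ cQ)
    (hQn : ∀ A : Space115 L η lev₀ lev₁ Dc, ‖blockRead115 (L := L) (η := η) (lev₀ := lev₀) (levB := levB) φ lev₁ Dc Q A‖ ≤ cQ * ‖A‖)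
    (hG : ∀ f : NegSize L η lev₀ 3 V, ‖toCLM115 lev₁ Dc (G1Fun φ G) f‖ ≤ c₁ * ‖f‖) (f : NegSize L η lev₀ 3 V) :
    ‖curToBlockRead (L := L) (η := η) (lev₀ := lev₀) (levB := levB) φ (Q ∘ₗ G) f‖ ≤ cQ * c₁ * ‖f‖ := by
  rw [curToBlockRead_comp (levB := levB) φ lev₁ Dc Q G, ContinuousLinearMap.comp_apply]
  exact (hQn _).trans ((mul_le_mul_of_nonneg_left (hG f) hcQ).trans_eq (by ring))

end Generic

/-! ## §2 At the record: `qG1ReadAt = qReadAt ∘ g1CurReadAt`, (QG) from (G₃) and the averaging letter (Q♯), and the (117) letter of `𝔊(U₀; Δ₁)` with (QG) discharged modulo (G₃) + (Q♯) -/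

section Record

variable (F : T4Family) (N : ℕ) (K k : ℕ) (Ω : ℕ → Set (Site (F.P K) 0)) (U₀ : GaugeField (F.P K) 0 (SU N))
  {β : Type*} [Fintype β] {wB : β → ℝ} [Fact (∀ y, 0 < wB y)] {F' : Type*} [AddCommGroup F'] [Module ℂ F']
variable [Fact (0 < (F.L : ℝ))] [Fact (0 < (F.P K).eta k)] [Fact (0 < c0Rec F K k)]

/-- **def-Y's averaging slot `Q` (`QprOfRecord U₀ 𝔥`, `QOfRecord U₀`, …) READ FROM (115) TO THE BLOCKS at the record**, block levels `levB`.  A reading, nothing asserted; its operator bound is the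
letter (Q♯) below (print: a block average with unitary transporters; for the framed `Q^{pr}` the frame datum's derivative enters the constant).
[cite: Balaban1985BackgroundPropagators, (3.13)–(3.16) p.393, (3.113)–(3.114) p.418; Balaban1985Variational, (44)–(45) p.285] -/
def qReadAt (Q : BondL2K ℂ (F.P K).d (fun _ => (F.P K).sitesPerDir 0) (c0Rec F K k) (WRec N) →ₗ[ℂ] WL2 ℂ wB (WRec N)) (levB : β → ℕ) :
    Space115Lit F N K k Ω U₀ →L[ℂ] NegSize (F.L : ℝ) ((F.P K).eta k) levB 0 (Matrix (Fin N) (Fin N) ℂ) :=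
  blockRead115 (L := (F.L : ℝ)) (η := (F.P K).eta k) (lev₀ := bondLevLit F Ω k) (levB := levB) (phiRec N) (pairLevLit F Ω k)
    (nabla115 ((F.P K).eta k) (unitsOfRecord F N U₀)) Q

variable (Δ₁ : BondL2K ℂ (F.P K).d (fun _ => (F.P K).sitesPerDir 0) (c0Rec F K k) (WRec N) →ₗ[ℂ] BondL2K ℂ (F.P K).d (fun _ => (F.P K).sitesPerDir 0) (c0Rec F K k) (WRec N))
  (Q : BondL2K ℂ (F.P K).d (fun _ => (F.P K).sitesPerDir 0) (c0Rec F K k) (WRec N) →ₗ[ℂ] WL2 ℂ wB (WRec N))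
  (Q' : SiteL2K ℂ (F.P K).d (fun _ => (F.P K).sitesPerDir 0) (c0Rec F K k) (WRec N) →ₗ[ℂ] F') (a : ℝ)
  (hpos : ∀ x, x ≠ 0 → 0 < RCLike.re ⟪x, laplaceAOfRecordAt F N k U₀ Δ₁ Q Q' a x⟫_ℂ) (levB : β → ℕ)

/-- ★ **`QG₁(U₀; Δ₁)` ON THE CURRENTS = (Q on (115)) ∘ (G₁ on the currents)** at the record. [cite: Balaban1985BackgroundPropagators, (3.153) p.426; Balaban1985Variational, (111) p.294] -/
theorem qG1ReadAt_eq_comp :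
    qG1ReadAt F N K k Ω U₀ Δ₁ Q Q' a hpos levB = (qReadAt F N K k Ω U₀ Q levB).comp (g1CurReadAt F N K k Ω U₀ Δ₁ Q Q' a hpos) :=
  curToBlockRead_comp (levB := levB) (phiRec N) (pairLevLit F Ω k) (nabla115 ((F.P K).eta k) (unitsOfRecord F N U₀)) Q (G1LatticeK hpos)

/-- ★★ **(QG) MODULO (G₃) AT THE RECORD** (★★★ director-ym №673 (2)): the averaging letter (Q♯) `‖qReadAt … Q levB A‖ ≤ c_Q‖A‖₍₁₁₅₎` (`c_Q ≥ 0`; a bound on def-Y's averaging slot ALONE) and (G₃)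
`‖g1CurReadAt … hpos J‖₍₁₁₅₎ ≤ c₁|J|₍₋₃₎` (Theorem 3.3-type) ⟹ (QG) `|qG1ReadAt … hpos levB J|₍₋₀₎ ≤ c_Q·c₁·|J|₍₋₃₎`.  Nothing of [B9] Sects. B–C beyond (G₃) is used.
[cite: Balaban1985Variational, (117) p.295, (44)–(45) p.285; Balaban1985BackgroundPropagators, Thm 3.3 p.397, (3.16) p.393, (3.153) p.426] -/
theorem norm_qG1ReadAt_le_of_g1Cur {cQ c₁ : ℝ} (hcQ : 0 ≤ cQ) (hQn : ∀ A : Space115Lit F N K k Ω U₀, ‖qReadAt F N K k Ω U₀ Q levB A‖ ≤ cQ * ‖A‖)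
    (hG3 : ∀ J : NegSizeLit F N K k Ω 3, ‖g1CurReadAt F N K k Ω U₀ Δ₁ Q Q' a hpos J‖ ≤ c₁ * ‖J‖) (J : NegSizeLit F N K k Ω 3) :
    ‖qG1ReadAt F N K k Ω U₀ Δ₁ Q Q' a hpos levB J‖ ≤ cQ * c₁ * ‖J‖ :=
  norm_curToBlockRead_comp_le (levB := levB) (phiRec N) (pairLevLit F Ω k) (nabla115 ((F.P K).eta k) (unitsOfRecord F N U₀)) Q (G1LatticeK hpos) hcQ hQn hG3 J

/-- ★★★ **THE (117) LETTER OF `𝔊(U₀; Δ₁)` WITH (QG) DISCHARGED MODULO (G₃) + (Q♯)**: (G₃) `‖G₁J‖₍₁₁₅₎ ≤ c₁|J|₍₋₃₎`, (Q♯) `‖Q A‖₍₋₀₎ ≤ c_Q‖A‖₍₁₁₅₎`, (ℓa-H) `Prop4LetterH (H₁(U₀; Δ₁)) b`,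
(L) `‖G₁DRD*G₁J‖₍₁₁₅₎ ≤ c₄|J|₍₋₃₎` (`b, c_Q ≥ 0`) ⟹ `Prop4LetterH (𝔊(U₀; Δ₁)) (c₁ + b·(c_Q c₁) + c₄)` — ✓`prop4LetterH_frakGOfRecordAt_of_parts` with its (QG) slot fed by `norm_qG1ReadAt_le_of_g1Cur`;
the bill for row 21's (117) letter is now (G₃) + (K)-free (ℓa-H) + (L) from [B9] Sects. B–D plus ONE averaging letter (Q♯).
[cite: Balaban1985Variational, (116)–(117) p.295, (46) p.285; Balaban1985BackgroundPropagators, Thm 3.13 p.426, Thm 3.3 p.397, (3.124) p.420, (3.153) p.426] -/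
theorem prop4LetterH_frakGOfRecordAt_of_G3_Qsharp (hQ : Function.Surjective Q) {c₁ cQ b c₄ : ℝ} (hb : 0 ≤ b) (hcQ : 0 ≤ cQ)
    (hG3 : ∀ J : NegSizeLit F N K k Ω 3, ‖g1CurReadAt F N K k Ω U₀ Δ₁ Q Q' a hpos J‖ ≤ c₁ * ‖J‖)
    (hQn : ∀ A : Space115Lit F N K k Ω U₀, ‖qReadAt F N K k Ω U₀ Q levB A‖ ≤ cQ * ‖A‖)
    (h3 : Prop4LetterH (H1OfRecordAt F N K k Ω U₀ levB Δ₁ Q Q' a hpos hQ) b)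
    (h4 : ∀ J : NegSizeLit F N K k Ω 3, ‖g1LapG1ReadAt F N K k Ω U₀ Δ₁ Q Q' a hpos J‖ ≤ c₄ * ‖J‖) :
    Prop4LetterH (frakGOfRecordAt F N K k Ω U₀ Δ₁ Q Q' a hpos hQ) (c₁ + b * (cQ * c₁) + c₄) :=
  prop4LetterH_frakGOfRecordAt_of_parts F N K k Ω U₀ Δ₁ Q Q' a hpos levB hQ hb hG3 (norm_qG1ReadAt_le_of_g1Cur F N K k Ω U₀ Δ₁ Q Q' a hpos levB hcQ hQn hG3) h3 h4

end Record

end Summit.QuantumFields.YangMills.BalabanUVNodes.N07QG1LetterOfG3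

end
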